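import Literature.Analysis.OperatorTheory.SupNormCompactOperator
import Mathlib.MeasureTheory.Function.ConvergenceInMeasure
import Mathlib.Analysis.Normed.Operator.Banach
import Mathlib.LinearAlgebra.Dimension.Free
import HarnessLib

/-!
# Godement's lemma: a closed subspace of `L²` of a finite measure space consisting of essentially
# bounded functions is finite-dimensional (Borel, *Automorphic forms on `SL₂(ℝ)`* (1997), Lemma 8.3)

Topic `Literature/Analysis/OperatorTheory`; sibling of `SupNormCompactOperator`, whose
Hilbert–Schmidt bound `sum_norm_sq_le_of_eLpNorm_top_le` (for `T : V → L²(μ)` with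
`‖T φ‖_∞ ≤ C ‖φ‖` and an orthonormal family `(eᵢ)` of `V`, `∑ ‖T eᵢ‖²₂ ≤ C² μ(X)`; Getz–Hahn
Lemma 9.3.2, after Borel Thm. 9.5) is here applied to the inclusion of a subspace. The result is
the lemma of Godement (proof of Hörmander) printed as Lemma 8.3 of Borel (1997), p. 64: *let
`μ(Z) < ∞` and let `V` be a closed subspace of `L²(Z, μ)` that consists of essentially bounded
functions; then `V` is finite dimensional*, with the bound `dim V ≤ c² μ(Z)` for the constant of
`‖f‖_∞ ≤ c ‖f‖₂` on `V` (loc. cit., end of proof: "`n ≤ c² μ(Z)`"). It is the kernel step of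
Harish-Chandra's finiteness theorem for automorphic forms (Borel 1997, Thm. 8.5; Harish-Chandra,
LNM 62 (1968), Lemma 9 and Thm. 1; `Literature.NumberTheory.Automorphic.harishChandra_finiteness`):
the cusp forms of a given type are bounded and form a closed subspace of `L²(Γ \ G)`.

* `finrank_le_of_eLpNorm_top_le` — **the quantitative form**: if `W ≤ L²(μ)` is
  finite-dimensional and `‖f‖_∞ ≤ C ‖f‖₂` on `W`, then `dim W ≤ C² μ(X)` (an orthonormal basis of
  `W` is an orthonormal family of norm-one vectors for the inclusion `W ↪ L²(μ)`).
* `finiteDimensional_of_eLpNorm_top_le` — **without assuming finite dimension**: the same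
  hypothesis on an arbitrary subspace `W` forces `W` to be finite-dimensional, of dimension
  `≤ C² μ(X)` (every linearly independent finite subset spans a subspace to which the quantitative
  form applies; Mathlib's `rank_le`).
* `exists_eLpNorm_top_le_of_isClosed` — **the closed-graph step** (Borel's (2), via the open
  mapping / closed graph theorem): if `W` is closed in `L²(μ)` and consists of essentially bounded
  functions, there is `C ≥ 0` with `‖f‖_∞ ≤ C ‖f‖₂` on `W` (the identity `W → L^∞(μ)` has closed
  graph, because `L^∞`- and `L²`-limits agree a.e. along a subsequence).
* `finiteDimensional_of_isClosed_of_eLpNorm_top_lt_top` — **Godement's lemma** (Borel 1997,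
  Lemma 8.3) as printed.

Everything is proved; there are no definitions.

## References

* A. Borel, *Automorphic forms on `SL₂(ℝ)`*, Cambridge Tracts in Math. 130 (1997), Lemma 8.3
  (PDF p. 64), Thm. 8.5 [Borel1997].
* J. R. Getz, H. Hahn, *An Introduction to Automorphic Representations*, GTM 300 (2024),
  Lemma 9.3.2 [GetzHahn2024].
* Harish-Chandra, *Automorphic forms on semisimple Lie groups*, LNM 62 (1968), §2, Lemma 9.
-/

open Filter Topology MeasureTheory Module
open scoped ENNReal

namespace Literature.Analysis.OperatorTheory

variable {𝕜 : Type*} [RCLike 𝕜] {X : Type*} [MeasurableSpace X] {μ : Measure X}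

/-! ### The quantitative form -/

section Quantitative

variable [IsFiniteMeasure μ]

/-- **`dim W ≤ C² μ(X)` for a finite-dimensional `W ≤ L²(μ)` with `‖f‖_∞ ≤ C ‖f‖₂` on `W`**
(Borel 1997, proof of Lemma 8.3, (3)–(4): for an orthonormal basis `v₁, …, vₙ` of `W`,
`∑ |vᵢ(z)|² ≤ c²` a.e., whence `n ≤ c² μ(Z)`), from the Hilbert–Schmidt bound
`sum_norm_sq_le_of_eLpNorm_top_le` applied to the inclusion `W ↪ L²(μ)` and the standard
orthonormal basis of `W`. [cite: Borel1997, Lemma 8.3] -/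
theorem finrank_le_of_eLpNorm_top_le (W : Submodule 𝕜 (Lp 𝕜 2 μ)) [FiniteDimensional 𝕜 W]
    {C : ℝ} (hC : 0 ≤ C) (hW : ∀ f ∈ W, eLpNorm f ∞ μ ≤ ENNReal.ofReal (C * ‖f‖)) :
    (finrank 𝕜 W : ℝ) ≤ C ^ 2 * μ.real Set.univ := by
  have h := sum_norm_sq_le_of_eLpNorm_top_le (W.subtypeL) hC (fun φ => hW φ φ.2)
    (stdOrthonormalBasis 𝕜 W).orthonormal
  have hone : ∀ i, ‖W.subtypeL ((stdOrthonormalBasis 𝕜 W) i)‖ ^ 2 = 1 := fun i => by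
    have h1 : ‖(stdOrthonormalBasis 𝕜 W) i‖ = 1 := (stdOrthonormalBasis 𝕜 W).norm_eq_one i
    rw [Submodule.subtypeL_apply, Submodule.norm_coe, h1, one_pow]
  simp only [hone, Finset.sum_const, Finset.card_univ, Fintype.card_fin, nsmul_eq_mul,
    mul_one] at h
  exact h

/-- **A subspace of `L²(μ)` on which `‖f‖_∞ ≤ C ‖f‖₂` is finite-dimensional, of dimension
`≤ C² μ(X)`** (Borel 1997, Lemma 8.3, the dimension count, with no closedness or finite dimension
assumed): every linearly independent finite subset of `W` spans a finite-dimensional subspace to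
which `finrank_le_of_eLpNorm_top_le` applies, so its size is `≤ C² μ(X)` (`rank_le`).
[cite: Borel1997, Lemma 8.3] -/
theorem finiteDimensional_of_eLpNorm_top_le (W : Submodule 𝕜 (Lp 𝕜 2 μ))
    {C : ℝ} (hC : 0 ≤ C) (hW : ∀ f ∈ W, eLpNorm f ∞ μ ≤ ENNReal.ofReal (C * ‖f‖)) :
    FiniteDimensional 𝕜 W ∧ (finrank 𝕜 W : ℝ) ≤ C ^ 2 * μ.real Set.univ := by
  -- every finite-dimensional subspace of `W` has dimension `≤ C² μ(X)`
  have hsub : ∀ E : Submodule 𝕜 W, FiniteDimensional 𝕜 E →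
      (finrank 𝕜 E : ℝ) ≤ C ^ 2 * μ.real Set.univ := by
    intro E hE
    haveI : FiniteDimensional 𝕜 (E.map W.subtype) := inferInstance
    have h := finrank_le_of_eLpNorm_top_le (E.map W.subtype) hC (fun f hf => ?_)
    · rwa [Submodule.finrank_map_subtype_eq] at h
    · obtain ⟨g, -, rfl⟩ := hf
      exact hW _ g.2
  -- hence the rank of `W` is bounded
  set N : ℕ := ⌊C ^ 2 * μ.real Set.univ⌋₊ with hN
  have hrank : Module.rank 𝕜 W ≤ N := by
    refine rank_le fun s hs => ?_
    have hli : LinearIndepOn 𝕜 id (s : Set W) := hs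
    have hE := hsub (Submodule.span 𝕜 (s : Set W)) inferInstance
    rw [finrank_span_finset_eq_card hli] at hE
    exact Nat.le_floor hE
  haveI hfin : FiniteDimensional 𝕜 W :=
    Module.rank_lt_aleph0_iff.1 (hrank.trans_lt Cardinal.natCast_lt_aleph0)
  exact ⟨hfin, hsub ⊤ inferInstance |>.trans_eq' (by rw [finrank_top])⟩

end Quantitative

/-! ### The closed-graph step and Godement's lemma -/

section ClosedGraph

/-- **On a closed subspace of `L²(μ)` consisting of essentially bounded functions,
`‖f‖_∞ ≤ C ‖f‖₂`** (Borel 1997, proof of Lemma 8.3, (1)–(2): the identity of `V` from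
`(V, ‖·‖₂)` to `(V, ‖·‖_∞)` is continuous by the open mapping theorem). Here: the linear map
`W → L^∞(μ)` sending `f` to its own class has closed graph — if `fₙ → f` in `L²` and `fₙ → g` in
`L^∞`, both convergences are convergences in measure, so along a subsequence `fₙ → f` and `fₙ → g`
a.e., and `g = f` — hence it is continuous (`LinearMap.continuous_of_seq_closed_graph`, `W` being
complete as a closed subspace), and its operator norm is the constant. [cite: Borel1997, Lemma 8.3] -/
theorem exists_eLpNorm_top_le_of_isClosed (W : Submodule 𝕜 (Lp 𝕜 2 μ))
    (hWc : IsClosed (W : Set (Lp 𝕜 2 μ))) (hW : ∀ f ∈ W, eLpNorm f ∞ μ < ∞) :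
    ∃ C : ℝ, 0 ≤ C ∧ ∀ f ∈ W, eLpNorm f ∞ μ ≤ ENNReal.ofReal (C * ‖f‖) := by
  -- the class of `f ∈ W` in `L^∞`
  have hmem : ∀ f : W, ((f : Lp 𝕜 2 μ) : X →ₘ[μ] 𝕜) ∈ Lp 𝕜 ∞ μ := fun f => by
    rw [Lp.mem_Lp_iff_eLpNorm_lt_top]
    exact hW f f.2
  let T : W →ₗ[𝕜] Lp 𝕜 ∞ μ :=
    { toFun := fun f => ⟨((f : Lp 𝕜 2 μ) : X →ₘ[μ] 𝕜), hmem f⟩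
      map_add' := fun f g => rfl
      map_smul' := fun c f => rfl }
  have hTcoe : ∀ f : W, ((T f : Lp 𝕜 ∞ μ) : X → 𝕜) = ((f : Lp 𝕜 2 μ) : X → 𝕜) := fun f => rfl
  -- `W` is complete
  haveI : CompleteSpace W := hWc.completeSpace_coe
  -- closed graph
  have hcont : Continuous T := by
    refine T.continuous_of_seq_closed_graph fun u x y hu hTu => ?_
    -- a.e. convergence of a subsequence to `y` (from `L^∞` convergence)
    have h1 : TendstoInMeasure μ (fun n => ((T (u n) : Lp 𝕜 ∞ μ) : X → 𝕜)) atTop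
        ((y : Lp 𝕜 ∞ μ) : X → 𝕜) := tendstoInMeasure_of_tendsto_Lp hTu
    obtain ⟨ns₁, hns₁, hae₁⟩ := h1.exists_seq_tendsto_ae
    -- a.e. convergence of a further subsequence to `x` (from `L²` convergence)
    have h2 : Tendsto (fun i => ((u (ns₁ i) : W) : Lp 𝕜 2 μ)) atTop (𝓝 ((x : W) : Lp 𝕜 2 μ)) :=
      ((continuous_subtype_val.tendsto x).comp hu).comp hns₁.tendsto_atTop
    have h2' : TendstoInMeasure μ (fun i => (((u (ns₁ i) : W) : Lp 𝕜 2 μ) : X → 𝕜)) atTop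
        (((x : W) : Lp 𝕜 2 μ) : X → 𝕜) := tendstoInMeasure_of_tendsto_Lp h2
    obtain ⟨ns₂, hns₂, hae₂⟩ := h2'.exists_seq_tendsto_ae
    -- the two limits agree a.e.
    apply Lp.ext
    filter_upwards [hae₁, hae₂] with z hz₁ hz₂
    have hz₁' : Tendsto (fun i => ((T (u (ns₁ (ns₂ i))) : Lp 𝕜 ∞ μ) : X → 𝕜) z) atTop
        (𝓝 (((y : Lp 𝕜 ∞ μ) : X → 𝕜) z)) := hz₁.comp hns₂.tendsto_atTop
    simp only [hTcoe] at hz₁'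
    rw [hTcoe]
    exact tendsto_nhds_unique hz₁' hz₂
  -- the operator norm is the constant
  let Tc : W →L[𝕜] Lp 𝕜 ∞ μ := ⟨T, hcont⟩
  refine ⟨‖Tc‖, ContinuousLinearMap.opNorm_nonneg Tc, fun f hf => ?_⟩
  have hle : ‖T ⟨f, hf⟩‖ ≤ ‖Tc‖ * ‖(⟨f, hf⟩ : W)‖ := Tc.le_opNorm _
  have heq : eLpNorm f ∞ μ = eLpNorm (T ⟨f, hf⟩ : Lp 𝕜 ∞ μ) ∞ μ := by
    rw [eLpNorm_congr_ae (Eventually.of_forall fun z => ?_)]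
    exact (congrFun (hTcoe ⟨f, hf⟩) z).symm
  rw [heq, ← ENNReal.ofReal_toReal (Lp.eLpNorm_ne_top (T ⟨f, hf⟩ : Lp 𝕜 ∞ μ)), ← Lp.norm_def]
  exact ENNReal.ofReal_le_ofReal (by simpa [Submodule.coe_norm] using hle)

/-- **Godement's lemma** (Borel 1997, Lemma 8.3, "due to R. Godement, proof of L. Hörmander";
Harish-Chandra, LNM 62, Lemma 9). Let `μ` be a finite measure and `V` a closed subspace of
`L²(X, μ)` consisting of essentially bounded functions (`‖f‖_∞ < ∞` for `f ∈ V`). Then `V` is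
finite-dimensional (and `dim V ≤ C² μ(X)` for the constant `C` of `exists_eLpNorm_top_le_of_isClosed`,
by `finiteDimensional_of_eLpNorm_top_le`). Borel states it for a locally compact `Z` with a positive
measure; only `μ(Z) < ∞` is used. [cite: Borel1997, Lemma 8.3] -/
theorem finiteDimensional_of_isClosed_of_eLpNorm_top_lt_top [IsFiniteMeasure μ]
    (V : Submodule 𝕜 (Lp 𝕜 2 μ)) (hVc : IsClosed (V : Set (Lp 𝕜 2 μ)))
    (hV : ∀ f ∈ V, eLpNorm f ∞ μ < ∞) : FiniteDimensional 𝕜 V := by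
  obtain ⟨C, hC, hle⟩ := exists_eLpNorm_top_le_of_isClosed V hVc hV
  exact (finiteDimensional_of_eLpNorm_top_le V hC hle).1

end ClosedGraph

end Literature.Analysis.OperatorTheory
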